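import Summits.NavierStokesRegularity.NavierStokesRegularity.Theorems.SwirlFreeBudget
import HarnessLib

/-!
# SwirlFreeBudget, toward crux K-18.1 `EtaMoserBound` (T-18.2): the gauges `A`, `E` on axis-centred
# sub-cylinders with an earlier top time (memo Appendix A.7, "monotonicity of the scaled quantities
# under inclusion with the normalisation made explicit") (seat nsreg-p4 g12)

Support file for the DORMANT route `SwirlThreshold` (crux stmt-NavierStokesRegularity-2002) and
planner nsreg-p2's ROUND-18 Appendix A.  The η-Moser lemma is proved on CLOSED sub-cylinders
`Q((t₁, x₀), R₂) ⊆ Q((t₀, x₀), R)` (same spatial centre on the axis, top time `t₁ ≤ t₀`,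
`t₀ - R² ≤ t₁ - R₂²`, `R₂ ≤ R`) and its gauges there are compared with the given ones:
`A((t₁,x₀), R₂) ≤ (R/R₂) A((t₀,x₀), R)` (`cknA_sub_le`), `E((t₁,x₀), R₂) ≤ (R/R₂) E((t₀,x₀), R)`
(`cknE_sub_le`), and the inclusion itself (`parabolicCylinder_sub_subset`).

WHAT THIS IS NOT: not NS regularity — bookkeeping of scale-invariant quantities; `EtaMoserBound` stays
OPEN; no crux claim.
-/

namespace Summit.NavierStokesRegularity.NavierStokesRegularity.Theorems.SwirlFreeBudget

open MeasureTheory Set Filter Topology Metric Function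
open scoped ENNReal NNReal
open Literature.Analysis Literature.Analysis.FluidPDE

noncomputable section

/-- The sub-cylinder with the same spatial centre, an earlier top time and a window inside the big
one lies inside: `Q((t₁, x₀), R₂) ⊆ Q((t₀, x₀), R)`. -/
theorem parabolicCylinder_sub_subset {z₀ : ℝ × EuclideanSpace ℝ (Fin 3)} {t₁ R R₂ : ℝ}
    (hR₂R : R₂ ≤ R) (ht₁ : t₁ ≤ z₀.1) (hwin : z₀.1 - R ^ 2 ≤ t₁ - R₂ ^ 2) :
    parabolicCylinder R₂ ((t₁, z₀.2) : ℝ × EuclideanSpace ℝ (Fin 3)) ⊆ parabolicCylinder R z₀ := by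
  intro w hw
  rw [mem_parabolicCylinder] at hw ⊢
  exact ⟨⟨by linarith [hw.1.1], by linarith [hw.1.2]⟩, hw.2.trans_le hR₂R⟩

/-- `ofReal (R/R₂) · (ofReal R)⁻¹ = (ofReal R₂)⁻¹` for `0 < R₂`, `0 < R`. -/
theorem ofReal_div_mul_inv {R R₂ : ℝ} (hR₂ : 0 < R₂) (hR : 0 < R) :
    ENNReal.ofReal (R / R₂) * (ENNReal.ofReal R)⁻¹ = (ENNReal.ofReal R₂)⁻¹ := by
  rw [ENNReal.ofReal_div_of_pos hR₂, div_eq_mul_inv, mul_comm (ENNReal.ofReal R), mul_assoc,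
    ENNReal.mul_inv_cancel (by rwa [ne_eq, ENNReal.ofReal_eq_zero, not_le]) ENNReal.ofReal_ne_top,
    mul_one]

/-- **`A` on the sub-cylinder**: `A((t₁, x₀), R₂) ≤ (R/R₂) · A((t₀, x₀), R)` (smaller ball,
shorter window inside the big one, normalisation `R₂⁻¹ = (R/R₂) R⁻¹`). -/
theorem cknA_sub_le {V : ℝ → EuclideanSpace ℝ (Fin 3) → EuclideanSpace ℝ (Fin 3)}
    {z₀ : ℝ × EuclideanSpace ℝ (Fin 3)} {t₁ R R₂ : ℝ} (hR₂ : 0 < R₂) (hR₂R : R₂ ≤ R)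
    (ht₁ : t₁ ≤ z₀.1) (hwin : z₀.1 - R ^ 2 ≤ t₁ - R₂ ^ 2) :
    cknA R₂ ((t₁, z₀.2) : ℝ × EuclideanSpace ℝ (Fin 3)) V ≤ ENNReal.ofReal (R / R₂) * cknA R z₀ V := by
  have hR : 0 < R := hR₂.trans_le hR₂R
  unfold cknA
  refine iSup₂_le fun t ht => ?_
  have ht' : t ∈ Ioo (z₀.1 - R ^ 2) z₀.1 := ⟨by linarith [ht.1], by linarith [ht.2]⟩
  have hball : ∫⁻ x in ball z₀.2 R₂, ‖V t x‖ₑ ^ 2 ≤ ∫⁻ x in ball z₀.2 R, ‖V t x‖ₑ ^ 2 :=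
    lintegral_mono_set (ball_subset_ball hR₂R)
  calc (ENNReal.ofReal R₂)⁻¹ * ∫⁻ x in ball z₀.2 R₂, ‖V t x‖ₑ ^ 2
      ≤ (ENNReal.ofReal R₂)⁻¹ * ∫⁻ x in ball z₀.2 R, ‖V t x‖ₑ ^ 2 := mul_le_mul' le_rfl hball
    _ = ENNReal.ofReal (R / R₂) * ((ENNReal.ofReal R)⁻¹ * ∫⁻ x in ball z₀.2 R, ‖V t x‖ₑ ^ 2) := by
        rw [← mul_assoc, ofReal_div_mul_inv hR₂ hR]
    _ ≤ ENNReal.ofReal (R / R₂) *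
          ⨆ s ∈ Ioo (z₀.1 - R ^ 2) z₀.1, (ENNReal.ofReal R)⁻¹ * ∫⁻ x in ball z₀.2 R, ‖V s x‖ₑ ^ 2 := by
        gcongr
        exact le_iSup₂_of_le (f := fun s (_ : s ∈ Ioo (z₀.1 - R ^ 2) z₀.1) =>
          (ENNReal.ofReal R)⁻¹ * ∫⁻ x in ball z₀.2 R, ‖V s x‖ₑ ^ 2) t ht' le_rfl

/-- **`E` on the sub-cylinder**: `E((t₁, x₀), R₂) ≤ (R/R₂) · E((t₀, x₀), R)`. -/
theorem cknE_sub_le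
    {G : ℝ → EuclideanSpace ℝ (Fin 3) → EuclideanSpace ℝ (Fin 3) →L[ℝ] EuclideanSpace ℝ (Fin 3)}
    {z₀ : ℝ × EuclideanSpace ℝ (Fin 3)} {t₁ R R₂ : ℝ} (hR₂ : 0 < R₂) (hR₂R : R₂ ≤ R)
    (ht₁ : t₁ ≤ z₀.1) (hwin : z₀.1 - R ^ 2 ≤ t₁ - R₂ ^ 2) :
    cknE R₂ ((t₁, z₀.2) : ℝ × EuclideanSpace ℝ (Fin 3)) G ≤ ENNReal.ofReal (R / R₂) * cknE R z₀ G := by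
  have hR : 0 < R := hR₂.trans_le hR₂R
  unfold cknE
  calc (ENNReal.ofReal R₂)⁻¹ * ∫⁻ q in parabolicCylinder R₂ ((t₁, z₀.2) : ℝ × EuclideanSpace ℝ (Fin 3)),
        ENNReal.ofReal (frobeniusNormSq (G q.1 q.2))
      ≤ (ENNReal.ofReal R₂)⁻¹ * ∫⁻ q in parabolicCylinder R z₀, ENNReal.ofReal (frobeniusNormSq (G q.1 q.2)) :=
        mul_le_mul' le_rfl (lintegral_mono_set (parabolicCylinder_sub_subset hR₂R ht₁ hwin))
    _ = ENNReal.ofReal (R / R₂) * ((ENNReal.ofReal R)⁻¹ *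
          ∫⁻ q in parabolicCylinder R z₀, ENNReal.ofReal (frobeniusNormSq (G q.1 q.2))) := by
        rw [← mul_assoc, ofReal_div_mul_inv hR₂ hR]

end

end Summit.NavierStokesRegularity.NavierStokesRegularity.Theorems.SwirlFreeBudget
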